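import Summits.RiemannHypothesis.RiemannHypothesis.Theorems.WeilColumnThetaCut
import Summits.RiemannHypothesis.RiemannHypothesis.Theorems.WeilColumnTruncatedWitness
import Summits.RiemannHypothesis.RiemannHypothesis.Theorems.WeilColumnOddMollifier
import HarnessLib

/-!
# THETA kernel certificate, W3 (witness half): support, continuity, realness of the cut witness `g = G₀χ`, and THE TEST FUNCTION `φ_k = g⁻ ⋆ moll_k` (RH-FREE)

Cell `rh-explicit`, WEIL column, seat weil-1 gen19 (THETA-ASSIGN v1.0 §3 item W3, «cut & witness basics»; the CUT half is
handoff-prove-2's `WeilColumnThetaCut`, the fact `G₀ = 0` above the window is cc-s2-3's `WeilColumnTruncatedWitness`). Over the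
interface `WeilColumnThetaWitness` (p418783), for `P : ThetaParams` (and, where needed, an admissible row `hP : P.Admissible qn`):

* realness: `conj (P.h y) = P.h y`, `conj (P.Θ u) = P.Θ u`, `conj (P.G₀ x) = P.G₀ x`, `conj (P.g x) = P.g x`,
  `conj (P.gOdd x) = P.gOdd x`, `conj (P.phi k x) = P.phi k x` (no admissibility needed);
* support: `P.T x = 0` for `x ≥ x₁` and for `x > a`; `P.g x = 0` for `x ≤ −a` and for `x > a`, hence for `|x| > a`;
  `P.g x = P.G₀ x` on `[x₁, ∞)`; `tsupport P.g ⊆ [−a, a]`, `tsupport P.gOdd ⊆ [−a, a]`, both compactly supported;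
* continuity: `P.G₀`, `P.cut`, `P.g`, `P.T`, `P.gOdd`, `P.TOdd` are continuous;
* the test function handed to the semilocal form: `IsWeilTest (P.phi k)`, `P.phi k (−x) = −P.phi k x`,
  `P.phi k x = 0` for `|x| > a + 1/(k+1)`, `tsupport (P.phi k) ⊆ [−(a + 1/(k+1)), a + 1/(k+1)]`.

These are the hypotheses `hχ…`/continuity/`IsWeilTest`/support inputs of D3/D4/(P_R)/FIN stated as theorems of the witness.
Upper-clause bookkeeping only; nothing here bears on the truth of RH.
-/

noncomputable section

set_option linter.dupNamespace false

open Complex Set MeasureTheory Filter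
open scoped Real Topology ComplexConjugate

namespace Summit.RiemannHypothesis.RiemannHypothesis.Theorems.WeilColumn.ThetaMellin

open Literature.NumberTheory.LFunctions Literature.NumberTheory.LFunctions.WeilContinuous

/-! ## §1 Realness of the building blocks (generic) -/

/-- `conj (a·1_{[s,t]}(x)) = (conj a)·1_{[s,t]}(x)`. [folklore] -/
theorem conj_indicatorConst_apply (s t : ℝ) (a : ℂ) (x : ℝ) :
    conj (indicatorConst s t a x) = indicatorConst s t (conj a) x := by
  unfold indicatorConst
  by_cases hx : x ∈ Icc s t
  · rw [indicator_of_mem hx, indicator_of_mem hx]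
  · rw [indicator_of_notMem hx, indicator_of_notMem hx, map_zero]

/-- The two-step profile `h₀` is real-valued. [folklore] -/
theorem conj_stepProfile (c₁ m₀ c₂ ε α : ℝ) (u : ℝ) :
    conj (stepProfile c₁ m₀ c₂ ε α u) = stepProfile c₁ m₀ c₂ ε α u := by
  simp only [stepProfile, Pi.sub_apply, map_sub, conj_indicatorConst_apply, map_one, Complex.conj_ofReal]

/-- Every B-spline density is real-valued (conj form of `bsplineDensity_eq_ofReal_re`). [folklore] -/
theorem conj_bsplineDensity (c : ℝ) (k : ℕ) (t : ℝ) : conj (bsplineDensity c k t) = bsplineDensity c k t := by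
  rw [bsplineDensity_eq_ofReal_re c k t, Complex.conj_ofReal]

/-- The Weil convolution of two real-valued functions is real-valued. [folklore] -/
theorem conj_weilConv {f g : ℝ → ℂ} (hf : ∀ u, conj (f u) = f u) (hg : ∀ u, conj (g u) = g u) (t : ℝ) :
    conj (weilConv f g t) = weilConv f g t := by
  rw [weilConv_apply, ← integral_conj]
  refine integral_congr_ae (Eventually.of_forall fun u ↦ ?_)
  simp only [map_mul, hf, hg]

/-- The PART XIX profile `h = h₀ ⋆ ρ_ε` is real-valued. [folklore] -/
theorem conj_profile (c₁ m₀ c₂ ε α : ℝ) (m : ℕ) (y : ℝ) :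
    conj (profile c₁ m₀ c₂ ε α m y) = profile c₁ m₀ c₂ ε α m y :=
  conj_weilConv (conj_stepProfile c₁ m₀ c₂ ε α) (conj_bsplineDensity (ε / m) (m - 1)) y

namespace ThetaParams

variable (P : ThetaParams)

/-! ## §2 Realness of the witness (no admissibility needed) -/

/-- `h` is real-valued. [folklore] -/
theorem conj_h (y : ℝ) : conj (P.h y) = P.h y := conj_profile _ _ _ _ _ _ y

/-- `G = h(·/λ)` is real-valued. [folklore] -/
theorem conj_G (y : ℝ) : conj (P.G y) = P.G y := P.conj_h _

/-- `Θ = Σ G(n·)` is real-valued. [folklore] -/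
theorem conj_Θ (u : ℝ) : conj (P.Θ u) = P.Θ u := by
  show conj (thetaSum P.G u) = thetaSum P.G u
  rw [thetaSum, Complex.conj_tsum]
  exact tsum_congr fun n ↦ P.conj_G _

/-- `G₀ = e^{x/2}Θ(eˣ)` is real-valued. [folklore] -/
theorem conj_G₀ (x : ℝ) : conj (P.G₀ x) = P.G₀ x := by
  show conj (expProfile P.Θ x) = expProfile P.Θ x
  rw [expProfile, map_mul, Complex.conj_ofReal, P.conj_Θ]

/-- `g = G₀χ` is real-valued. [folklore] -/
theorem conj_g (x : ℝ) : conj (P.g x) = P.g x := by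
  rw [g, map_mul, P.conj_G₀, Complex.conj_ofReal]

/-- `T = G₀(1 − χ)` is real-valued. [folklore] -/
theorem conj_T (x : ℝ) : conj (P.T x) = P.T x := by
  rw [T, map_mul, P.conj_G₀, Complex.conj_ofReal]

/-- `g⁻` is real-valued. [folklore] -/
theorem conj_gOdd (x : ℝ) : conj (P.gOdd x) = P.gOdd x := by
  rw [gOdd, map_sub, P.conj_g, P.conj_g]

/-- `T⁻` is real-valued. [folklore] -/
theorem conj_TOdd (x : ℝ) : conj (P.TOdd x) = P.TOdd x := by
  rw [TOdd, map_sub, P.conj_T, P.conj_T]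

/-- `φ_k = g⁻ ⋆ moll_k` is real-valued. [folklore] -/
theorem conj_phi (k : ℕ) (x : ℝ) : conj (P.phi k x) = P.phi k x :=
  conj_weilConv P.conj_gOdd (Summit.RiemannHypothesis.RiemannHypothesis.Theorems.PfPersistence.conj_moll k) x

/-- `g x = ((g x).re : ℂ)` (real form). [folklore] -/
theorem g_eq_ofReal_re (x : ℝ) : P.g x = (((P.g x).re : ℝ) : ℂ) :=
  (Complex.conj_eq_iff_re.1 (P.conj_g x)).symm

/-- `g⁻ x = ((g⁻ x).re : ℂ)` (real form). [folklore] -/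
theorem gOdd_eq_ofReal_re (x : ℝ) : P.gOdd x = (((P.gOdd x).re : ℝ) : ℂ) :=
  (Complex.conj_eq_iff_re.1 (P.conj_gOdd x)).symm

/-- `φ_k x = ((φ_k x).re : ℂ)` (real form). [folklore] -/
theorem phi_eq_ofReal_re (k : ℕ) (x : ℝ) : P.phi k x = (((P.phi k x).re : ℝ) : ℂ) :=
  (Complex.conj_eq_iff_re.1 (P.conj_phi k x)).symm

/-! ## §3 Oddness of `φ_k` (no admissibility needed) -/

/-- `φ_k = g⁻ ⋆ moll_k` unfolded. [folklore] -/
theorem phi_apply (k : ℕ) (x : ℝ) : P.phi k x = ∫ u, P.gOdd u * moll k (x - u) := by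
  rw [phi, weilConv_apply]

/-- **`φ_k` is odd**: `φ_k(−x) = −φ_k(x)` (`g⁻` odd, `moll_k` even). [folklore] -/
theorem phi_neg (k : ℕ) (x : ℝ) : P.phi k (-x) = -P.phi k x := by
  -- adapted from `MotivicDoorSemilocalMollify.weilConv_moll_neg`
  simp only [phi_apply]
  rw [← integral_neg, ← integral_neg_eq_self (fun u ↦ P.gOdd u * moll k (-x - u)) volume]
  congr 1 with u
  rw [P.gOdd_neg, show -x - -u = -(x - u) by ring, Summit.RiemannHypothesis.RiemannHypothesis.Theorems.PfPersistence.moll_neg]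
  ring

/-! ## §4 Support of `T`, `g`, `g⁻` for an admissible row -/

variable {P}

/-- `0 < a` (`a = (log q)/2 + δ`, `δ > 0`, `log q ≥ 0`). [folklore] -/
theorem a_pos {qn : ℕ} (hP : P.Admissible qn) : 0 < P.a := by
  have h1 : 0 ≤ Real.log P.q := Real.log_natCast_nonneg P.q
  have h2 := hP.delta_pos
  unfold a; linarith

/-- `1 ≤ m` for an admissible row. -/
private theorem one_le_m {qn : ℕ} (hP : P.Admissible qn) : 1 ≤ P.m := le_trans (by norm_num) hP.three_le

/-- `2 ≤ m` for an admissible row. -/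
private theorem two_le_m {qn : ℕ} (hP : P.Admissible qn) : 2 ≤ P.m := le_trans (by norm_num) hP.three_le

/-- **The tail vanishes on `[x₁, ∞)`** (`χ = 1` there). [folklore] -/
theorem T_eq_zero_of_le {qn : ℕ} (hP : P.Admissible qn) {x : ℝ} (hx : P.x₁ ≤ x) : P.T x = 0 := by
  rw [T, P.cut_eq_one hP.eta_pos (one_le_m hP) hx]; simp

/-- The tail vanishes above the window too (`G₀ = 0` for `x > a`). [folklore] -/
theorem T_eq_zero_of_lt {qn : ℕ} (hP : P.Admissible qn) {x : ℝ} (hx : P.a < x) : P.T x = 0 := by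
  rw [T, P.G₀_eq_zero_of_lt hP hx, zero_mul]

/-- **`g = 0` on `(−∞, −a]`** (`χ = 0` there). [folklore] -/
theorem g_eq_zero_of_le {qn : ℕ} (hP : P.Admissible qn) {x : ℝ} (hx : x ≤ -P.a) : P.g x = 0 := by
  rw [g, P.cut_eq_zero hP.eta_pos (one_le_m hP) hx]; simp

/-- **`g = 0` on `(a, ∞)`** (`G₀ = 0` there). [folklore] -/
theorem g_eq_zero_of_lt {qn : ℕ} (hP : P.Admissible qn) {x : ℝ} (hx : P.a < x) : P.g x = 0 := by
  rw [g, P.G₀_eq_zero_of_lt hP hx, zero_mul]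

/-- `g x = 0` for `|x| > a`. [folklore] -/
theorem g_eq_zero_of_lt_abs {qn : ℕ} (hP : P.Admissible qn) {x : ℝ} (hx : P.a < |x|) : P.g x = 0 := by
  rcases le_or_gt 0 x with h0 | h0
  · exact g_eq_zero_of_lt hP (by rwa [abs_of_nonneg h0] at hx)
  · exact g_eq_zero_of_le hP (by rw [abs_of_neg h0] at hx; linarith)

/-- `g⁻ x = 0` for `|x| > a`. [folklore] -/
theorem gOdd_eq_zero_of_lt_abs {qn : ℕ} (hP : P.Admissible qn) {x : ℝ} (hx : P.a < |x|) : P.gOdd x = 0 := by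
  rw [gOdd, g_eq_zero_of_lt_abs hP hx, g_eq_zero_of_lt_abs hP (by rwa [abs_neg]), sub_zero]

/-- On `[x₁, ∞)` the cut is invisible: `g = G₀`. [folklore] -/
theorem g_eq_G₀_of_le {qn : ℕ} (hP : P.Admissible qn) {x : ℝ} (hx : P.x₁ ≤ x) : P.g x = P.G₀ x := by
  rw [g, P.cut_eq_one hP.eta_pos (one_le_m hP) hx]; simp

/-- `tsupport g ⊆ [−a, a]`. [folklore] -/
theorem tsupport_g_subset {qn : ℕ} (hP : P.Admissible qn) : tsupport P.g ⊆ Icc (-P.a) P.a := by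
  refine closure_minimal (fun x hx ↦ ?_) isClosed_Icc
  rw [Function.mem_support] at hx
  by_contra h
  refine hx (g_eq_zero_of_lt_abs hP ?_)
  rcases le_or_gt 0 x with h0 | h0
  · rw [abs_of_nonneg h0]
    by_contra hle
    exact h ⟨by linarith [not_lt.1 hle], not_lt.1 hle⟩
  · rw [abs_of_neg h0]
    by_contra hle
    exact h ⟨by linarith [not_lt.1 hle], by linarith [not_lt.1 hle]⟩

/-- `g` has compact support. [folklore] -/
theorem hasCompactSupport_g {qn : ℕ} (hP : P.Admissible qn) : HasCompactSupport P.g :=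
  HasCompactSupport.of_support_subset_isCompact isCompact_Icc ((subset_tsupport _).trans (tsupport_g_subset hP))

/-- `tsupport g⁻ ⊆ [−a, a]`. [folklore] -/
theorem tsupport_gOdd_subset {qn : ℕ} (hP : P.Admissible qn) : tsupport P.gOdd ⊆ Icc (-P.a) P.a := by
  refine closure_minimal (fun x hx ↦ ?_) isClosed_Icc
  rw [Function.mem_support] at hx
  by_contra h
  refine hx (gOdd_eq_zero_of_lt_abs hP ?_)
  rcases le_or_gt 0 x with h0 | h0
  · rw [abs_of_nonneg h0]
    by_contra hle
    exact h ⟨by linarith [not_lt.1 hle], not_lt.1 hle⟩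
  · rw [abs_of_neg h0]
    by_contra hle
    exact h ⟨by linarith [not_lt.1 hle], by linarith [not_lt.1 hle]⟩

/-- `g⁻` has compact support. [folklore] -/
theorem hasCompactSupport_gOdd {qn : ℕ} (hP : P.Admissible qn) : HasCompactSupport P.gOdd :=
  HasCompactSupport.of_support_subset_isCompact isCompact_Icc ((subset_tsupport _).trans (tsupport_gOdd_subset hP))

/-! ## §5 Continuity of `G₀`, `χ`, `g`, `T`, `g⁻`, `T⁻` for an admissible row -/

/-- `ProfileHyp` for the witness (local copy; the named version is cc-s2-3's `WeilColumnThetaWitnessBasics.profileHyp_G`). -/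
private theorem profileHyp_G_aux {qn : ℕ} (hP : P.Admissible qn) : ProfileHyp P.G (P.lam * P.c₁) (P.lam * P.c₂) := by
  have hm : 1 ≤ P.m := one_le_m hP
  have hε : 0 ≤ P.ε := by have := hP.delta_pos; have := hP.c₂_pos; unfold ε; positivity
  have hlam : 0 < P.lam := by have := hP.c₂_pos; unfold lam; positivity
  have hle : P.c₁ ≤ P.c₂ := by linarith [hP.seed₁, hP.seed₂]
  refine ⟨(P.continuous_h hP).comp (continuous_id.div_const _), mul_pos hlam hP.c₁_pos,
    mul_le_mul_of_nonneg_left hle hlam.le, fun t ht ↦ ?_⟩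
  refine Function.notMem_support.mp fun hmem ↦ ht ?_
  have hsub := support_profile_subset (α := P.α) hm hε hP.seed₂.le hP.seed₁.le hmem
  exact ⟨by have := (le_div_iff₀ hlam).mp hsub.1; linarith, by have := (div_le_iff₀ hlam).mp hsub.2; linarith⟩

/-- **`G₀` is continuous** (`Θ` is continuous on `(0,∞)` as a locally finite sum of continuous terms; `eˣ > 0`). [folklore] -/
theorem continuous_G₀ {qn : ℕ} (hP : P.Admissible qn) : Continuous P.G₀ := by
  have hΘ : ContinuousOn P.Θ (Ioi 0) := (profileHyp_G_aux hP).continuousOn_thetaSum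
  have h1 : Continuous fun x : ℝ ↦ P.Θ (Real.exp x) :=
    hΘ.comp_continuous Real.continuous_exp fun x ↦ Real.exp_pos x
  show Continuous fun x : ℝ ↦ (Real.exp (x / 2) : ℂ) * P.Θ (Real.exp x)
  exact (Complex.continuous_ofReal.comp (Real.continuous_exp.comp (continuous_id.div_const _))).mul h1

/-- The cut is continuous (`m ≥ 2`). [folklore] -/
theorem continuous_cut (hη : 0 < P.η) (hm : 2 ≤ P.m) : Continuous P.cut :=
  continuous_iff_continuousAt.2 fun x ↦ (P.hasDerivAt_cut hη hm x).continuousAt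

/-- `g` is continuous. [folklore] -/
theorem continuous_g {qn : ℕ} (hP : P.Admissible qn) : Continuous P.g := by
  show Continuous fun x ↦ P.G₀ x * (P.cut x : ℂ)
  exact (continuous_G₀ hP).mul (Complex.continuous_ofReal.comp (continuous_cut hP.eta_pos (two_le_m hP)))

/-- `T` is continuous. [folklore] -/
theorem continuous_T {qn : ℕ} (hP : P.Admissible qn) : Continuous P.T := by
  show Continuous fun x ↦ P.G₀ x * ((1 - P.cut x : ℝ) : ℂ)
  exact (continuous_G₀ hP).mul
    (Complex.continuous_ofReal.comp (continuous_const.sub (continuous_cut hP.eta_pos (two_le_m hP))))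

/-- `g⁻` is continuous. [folklore] -/
theorem continuous_gOdd {qn : ℕ} (hP : P.Admissible qn) : Continuous P.gOdd := by
  show Continuous fun x ↦ P.g x - P.g (-x)
  exact (continuous_g hP).sub ((continuous_g hP).comp continuous_neg)

/-- `T⁻` is continuous. [folklore] -/
theorem continuous_TOdd {qn : ℕ} (hP : P.Admissible qn) : Continuous P.TOdd := by
  show Continuous fun x ↦ P.T x - P.T (-x)
  exact (continuous_T hP).sub ((continuous_T hP).comp continuous_neg)

/-! ## §6 THE TEST FUNCTION `φ_k = g⁻ ⋆ moll_k` -/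

/-- **`φ_k` is a Weil test function** (smooth, compactly supported). [folklore; Bombieri 2000 §3 mollification] -/
theorem isWeilTest_phi {qn : ℕ} (hP : P.Admissible qn) (k : ℕ) : IsWeilTest (P.phi k) :=
  isWeilTest_weilConv_moll (continuous_gOdd hP) (hasCompactSupport_gOdd hP) k

/-- `φ_k` is continuous. [folklore] -/
theorem continuous_phi {qn : ℕ} (hP : P.Admissible qn) (k : ℕ) : Continuous (P.phi k) :=
  (isWeilTest_phi hP k).1.continuous

/-- **`φ_k x = 0` for `|x| > a + 1/(k+1)`** (the bump `moll_k` lives on `[−1/(k+1), 1/(k+1)]`). [folklore] -/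
theorem phi_eq_zero_of_lt_abs {qn : ℕ} (hP : P.Admissible qn) (k : ℕ) {x : ℝ} (hx : P.a + 1 / ((k : ℝ) + 1) < |x|) :
    P.phi k x = 0 := by
  -- adapted from `HandoffRouteEAssembly.weilConv_moll_eq_zero_of_radius` (not imported: heavy closure)
  rw [phi_apply]
  refine integral_eq_zero_of_ae (Eventually.of_forall fun u ↦ ?_)
  simp only [Pi.zero_apply]
  rcases le_or_gt (bump k).rOut |x - u| with hu | hu
  · rw [moll_eq_zero hu, mul_zero]
  · have h2 : P.a < |u| := by
      have := abs_sub_abs_le_abs_sub x u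
      rw [bump_rOut] at hu
      linarith
    rw [gOdd_eq_zero_of_lt_abs hP h2, zero_mul]

/-- **`tsupport φ_k ⊆ [−(a + 1/(k+1)), a + 1/(k+1)]`.** [folklore] -/
theorem tsupport_phi_subset {qn : ℕ} (hP : P.Admissible qn) (k : ℕ) :
    tsupport (P.phi k) ⊆ Icc (-(P.a + 1 / ((k : ℝ) + 1))) (P.a + 1 / ((k : ℝ) + 1)) := by
  refine closure_minimal (fun x hx ↦ ?_) isClosed_Icc
  rw [Function.mem_support] at hx
  by_contra h
  refine hx (phi_eq_zero_of_lt_abs hP k ?_)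
  rcases le_or_gt 0 x with h0 | h0
  · rw [abs_of_nonneg h0]
    by_contra hle
    exact h ⟨by linarith [not_lt.1 hle], not_lt.1 hle⟩
  · rw [abs_of_neg h0]
    by_contra hle
    exact h ⟨by linarith [not_lt.1 hle], by linarith [not_lt.1 hle]⟩

/-- The same with any radius `b ≥ a + 1/(k+1)` (the form FIN uses with `b = (log q⁺)/2`). [folklore] -/
theorem tsupport_phi_subset_of_le {qn : ℕ} (hP : P.Admissible qn) {k : ℕ} {b : ℝ} (hb : P.a + 1 / ((k : ℝ) + 1) ≤ b) :
    tsupport (P.phi k) ⊆ Icc (-b) b :=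
  (tsupport_phi_subset hP k).trans (Icc_subset_Icc (by linarith) hb)

/-- **Eventually the mollified witness fits the window**: if `a < b` then `tsupport φ_k ⊆ [−b, b]` for all large `k`. [folklore] -/
theorem eventually_tsupport_phi_subset {qn : ℕ} (hP : P.Admissible qn) {b : ℝ} (hb : P.a < b) :
    ∀ᶠ k : ℕ in atTop, tsupport (P.phi k) ⊆ Icc (-b) b := by
  have hk : ∀ᶠ k : ℕ in atTop, (bump k).rOut < b - P.a :=
    (tendsto_order.1 tendsto_bump_rOut).2 (b - P.a) (by linarith)
  filter_upwards [hk] with k hk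
  refine tsupport_phi_subset_of_le hP ?_
  rw [bump_rOut] at hk
  linarith

end ThetaParams

end Summit.RiemannHypothesis.RiemannHypothesis.Theorems.WeilColumn.ThetaMellin

end
-- build re-dispatch marker (comment-only re-land, 2026-08-26; no declaration changed)
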